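import Summits.QuantumFields.BalabanUV.Beta.MultiscaleCoerciveTorus
import Summits.QuantumFields.BalabanUV.Beta.MultiscaleCoerciveGauge
import Summits.QuantumFields.BalabanUV.Beta.CombGaugeComparison

/-!
# Beta / MultiscaleCoerciveTorusCov — THE COVARIANT TORUS INSTANCE: the multi-region COVARIANT averaged operator on pv21's torus
# `UT N` — block means through the contour transports `tr` of the cube combs ([B9] (3.19) at one step per level), ANY orthogonal
# bond matrices `Rm` — is locally, k-uniformly coercive under a (3.35)-LITERAL hypothesis ALONE: on each cell an orthogonal gauge
# whose gauged in-cube bond variables are `ε_k`-close to `1`.  With `D_k = d(S−1)` (comb depth) the per-cell loss is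
# `4d²S(S−1)ε_k² + 4(d(S−1)ε_k)² ≤ 8d²(Sε_k)²`: for `ε_k = C/S` (the |A|-half, `C = O(1)Mα₀`) a constant `θ = 8d²C²` INDEPENDENT of
# the cell side, the level, the number of levels and the volume — `(1 − θ)·min(c²/(4d), a/4)·Σ_cells S⁻²‖f‖²_cell ≤ ⟨f, levelOp f⟩`
# (unit `b2b-balaban-beta-d4-p2`, GEN 7, MODEL crew; claim «MULTISCALE-POINCARE-MODEL» journal l.16779∕l.17773, part (H); over
# (D) p226960, (F) p227519, (G) `CombGaugeComparison`)

HONEST FRAMING: discharging `BetaPertH` makes Bałaban's UV stability UNCONDITIONAL — NOT the continuum limit, NOT the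
Clay problem.  HONEST DEPENDENCY (verbatim): «continuum YM on T⁴ ⇐ BetaPertH ∧ nine spine estimates (0/9 proved);
BetaPertH ⇐ (D1) ∧ (D4) ∧ CAP+tail; G-an2-4 gates asym, D1 and NE2/3/4.»  THIS MODULE DISCHARGES NOTHING of `BetaPertH`,
asserts NOTHING printed and cites nothing as a fact (ABSOLUTE RULE): [folklore] about the pv21∕b05 torus MODEL (`UT N`, cube
combs `torusComb`, their transports `Comb.tr`, bonds `(x, μ)`); the bond matrices `Rm`, the per-cell gauges `g_k` and sizes `ε_k`
are DATA — (3.35) p. 396 is the SHAPE of the hypothesis («there exists a gauge transformation u on □ such that … |A| <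
O(1)Mα₀(L^jη)^{−1}»), not a fact used; nothing of Bałaban's own `U_k`, `Ū^l` (averaged legs), Dirichlet holes, region geometry
([B6] (2.1)–(2.2)), or the DECAY half of Thm 3.1.  No class change on row D4 (critical-path width 0; D4 DISCHARGE NO DATE); NOT
BetaPertH, NOT continuum, NOT Clay, NOT summit progress.

CONTENT (kernel, 0 sorry).  §1 offsets of chart points (`offV_cubePt`), the cell gauge read on the torus (`gext`).  §2 THE
BRIDGE from the per-cube bond hypothesis to part (G)'s comb hypothesis: a positive-depth site of the cube and its comb parent
are consecutive chart points along the comb axis (`parent_eq_cellPt`, `eq_cellPt_succ`), so the gauged comb-bond variable IS one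
of the gauged in-cube bond variables (`gbond_eq_hol`, `comb_gauge_of_cube_gauge`).  §3 END **`multiscale_coercive_torus_cov`**.
-/

namespace Summit.QuantumFields.BalabanUV.Beta.MultiscaleCoerciveTorusCov

open Finset Function
open Summit.QuantumFields.BalabanUV.Beta.BoxPoincare
open Summit.QuantumFields.BalabanUV.Beta.CovariantBoxPoincare
open Summit.QuantumFields.BalabanUV.Beta.CovariantBoxPoincareGauge
open Summit.QuantumFields.BalabanUV.Beta.MultiscaleCoercive
open Summit.QuantumFields.BalabanUV.Beta.MultiscaleCoerciveGauge
open Summit.QuantumFields.BalabanUV.Beta.MultiscaleCoerciveTorus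
open Summit.QuantumFields.BalabanUV.Beta.CombGaugeComparison
open Literature.MathematicalPhysics.QuantumFieldTheory.Balaban1983to89
open Literature.MathematicalPhysics.QuantumFieldTheory.Balaban1983to89.B9Thm37GluePU (bsrc btgt bsrc_apply btgt_apply)
open Literature.MathematicalPhysics.QuantumFieldTheory.Balaban1983to89.B9Thm37GlueTorusCov (Comb tblk tblk_val offs tdepth
  axis torusComb offs_dn_axis)
open Literature.MathematicalPhysics.QuantumFieldTheory.Balaban1983to89.B9Thm37GlueTorusCovPoinc (tdepth_le)
open Literature.MathematicalPhysics.QuantumFieldTheory.Balaban1983to89.B9Thm37GlueTorusCovLevels (levelOp)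
open Literature.MathematicalPhysics.QuantumFieldTheory.Balaban1983to89.B5Leibniz121 (up dn up_dn)
open B5TorusCover (UT Ctr ctrU)

noncomputable section

variable {d : ℕ} {N : Fin d → ℕ} [∀ i, NeZero (N i)] {Cp : Type} [Fintype Cp] [DecidableEq Cp]

/-! ## §1 Offsets of chart points; the cell gauge read on the torus -/

section Offsets

variable {M : ℕ}

/-- The offsets of a chart point are the chart coordinates. [folklore] -/
theorem offV_cubePt (hM : 1 ≤ M) (hdiv : ∀ i, M ∣ N i) (z : Ctr N M) (v : Box d M) :
    offV hM (cubePt hM hdiv z v) = v := by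
  funext i
  apply Fin.ext
  show (UT.toSite N (cubePt hM hdiv z v) i).val % M = (v i : ℕ)
  rw [cubePt_val, Nat.add_mul_mod_self_left, Nat.mod_eq_of_lt (v i).2]

omit [∀ i, NeZero (N i)] in
/-- The offset function `offs` is the value of `offV`. [folklore] -/
theorem offs_eq_offV (hM : 1 ≤ M) (x : UT N) (μ : Fin d) : offs M x μ = ((offV hM x) μ : ℕ) := rfl

/-- A box gauge read on the torus through the offsets: `gext g x = g(offsets of x)`. [folklore] -/
def gext (hM : 1 ≤ M) (g : Box d M → Cp → Cp → ℝ) (x : UT N) : Cp → Cp → ℝ := g (offV hM x)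

omit [Fintype Cp] [DecidableEq Cp] in
/-- On the chart the torus-read gauge is the box gauge. [folklore] -/
theorem gext_cubePt (hM : 1 ≤ M) (hdiv : ∀ i, M ∣ N i) (g : Box d M → Cp → Cp → ℝ) (z : Ctr N M) (v : Box d M) :
    gext hM g (cubePt hM hdiv z v) = g v := by
  rw [gext, offV_cubePt]

end Offsets

/-! ## §2 The bridge: the gauged comb-bond variable is a gauged in-cube bond variable -/

section Bridge

variable [NeZero d] {M : ℕ} (hM : 1 ≤ M) (hdiv : ∀ i, M ∣ N i) (z : Ctr N M)

/-- A positive-depth site of the cube `z`: its comb parent is the chart point of the parent's offsets, which lie in the cube.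
[folklore] -/
theorem parent_eq_cellPt {x : UT N} (hxz : tblk hM hdiv x = z) (hx : tdepth M x ≠ 0) :
    dn x (axis M x) = cubePt hM hdiv z (offV hM (dn x (axis M x))) := by
  have hblk : tblk hM hdiv (dn x (axis M x)) = z := by
    rw [← hxz]
    exact (torusComb hM hdiv).blk_parent x hx
  rw [← hblk]
  exact (cubePt_tblk_offV hM hdiv _).symm

/-- The offset of the parent along the comb axis has room for one more step. [folklore] -/
theorem offV_parent_lt {x : UT N} (hx : tdepth M x ≠ 0) :
    ((offV hM (dn x (axis M x))) (axis M x) : ℕ) + 1 < M := by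
  have h1 := (offs_dn_axis (N := N) hM hx).1
  have h2 : offs M x (axis M x) < M := Nat.mod_lt _ hM
  rw [offs_eq_offV hM, offs_eq_offV hM] at h1
  omega

/-- The site itself is the NEXT chart point along the comb axis. [folklore] -/
theorem eq_cellPt_succ {x : UT N} (hxz : tblk hM hdiv x = z) (hx : tdepth M x ≠ 0) :
    x = cubePt hM hdiv z (succ (offV hM (dn x (axis M x))) (axis M x) (offV_parent_lt hM hx)) := by
  rw [← up_cubePt hM hdiv z _ (axis M x) (offV_parent_lt hM hx), ← parent_eq_cellPt hM hdiv z hxz hx, up_dn]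

omit [DecidableEq Cp] in
/-- **The gauged comb-bond variable of a positive-depth cube site is the gauged in-cube bond variable of the bond from its parent**
(part (G)'s `gbond` for the torus-read gauge = part (B)'s `hol` for the box gauge). [folklore] -/
theorem gbond_eq_hol (Rm : UT N × Fin d → Cp → Cp → ℝ) (g : Box d M → Cp → Cp → ℝ) {x : UT N}
    (hxz : tblk hM hdiv x = z) (hx : tdepth M x ≠ 0) (c a : Cp) :
    gbond (torusComb hM hdiv) Rm (gext hM g) x c a =
      hol Rm g (fun v i _ => (cubePt hM hdiv z v, i)) (offV hM (dn x (axis M x))) (axis M x)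
        (offV_parent_lt hM hx) c a := by
  have hp : (torusComb hM hdiv).parent x = dn x (axis M x) := rfl
  have hb : (torusComb hM hdiv).pbond x = (dn x (axis M x), axis M x) := rfl
  have hgx : gext hM g x = g (succ (offV hM (dn x (axis M x))) (axis M x) (offV_parent_lt hM hx)) := by
    conv_lhs => rw [eq_cellPt_succ hM hdiv z hxz hx]
    exact gext_cubePt hM hdiv g z _
  rw [gbond, hol, hp, hb, hgx, ← parent_eq_cellPt hM hdiv z hxz hx]
  rfl

/-- **Part (G)'s block-local comb hypothesis from the per-cube bond hypothesis.** [folklore] -/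
theorem comb_gauge_of_cube_gauge (Rm : UT N × Fin d → Cp → Cp → ℝ) (g : Box d M → Cp → Cp → ℝ) {ε : ℝ}
    (hgauge : ∀ (v : Box d M) (i : Fin d) (hv : (v i : ℕ) + 1 < M) (u : Cp → ℝ),
      ∑ a', (∑ j, (hol Rm g (fun v i _ => (cubePt hM hdiv z v, i)) v i hv a' j - if a' = j then 1 else 0) * u j) ^ 2 ≤
        ε ^ 2 * ∑ j, u j ^ 2) :
    ∀ x, (torusComb hM hdiv).blk x = z → (torusComb hM hdiv).depth x ≠ 0 → ∀ w : Cp → ℝ,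
      ∑ c, (∑ a, (gbond (torusComb hM hdiv) Rm (gext hM g) x c a - if c = a then 1 else 0) * w a) ^ 2 ≤
        ε ^ 2 * ∑ a, w a ^ 2 := by
  intro x hxz hx w
  have hxz' : tblk hM hdiv x = z := hxz
  have hx' : tdepth M x ≠ 0 := hx
  simp_rw [gbond_eq_hol hM hdiv z Rm g hxz' hx']
  exact hgauge _ _ _ w

end Bridge

/-! ## §3 The covariant END on the torus -/

section End

variable [NeZero d] {J K : Type} [Fintype J] [Fintype K]

/-- **THE MULTI-REGION COVARIANT AVERAGED OPERATOR ON THE TORUS IS LOCALLY, k-UNIFORMLY COERCIVE UNDER A (3.35)-LITERAL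
HYPOTHESIS (MODEL).**  Torus `UT N`; levels `J` with cube sides `1 ≤ S_l ∣ N_i`; ANY orthogonal bond matrices `Rm`; the operator
`levelOp bsrc btgt c Rm (l x ↦ corner_l x) (l x ↦ ω_l(corner)) (l x ↦ tr_l x) a` — COVARIANT block means through the contour
transports of the level-`l` cube comb; a family of pairwise disjoint cubes with print-size weights; on each cell an orthogonal BOX
GAUGE `g_k` whose gauged in-cube bond variables are `ε_k`-close to `1` (quadratic-form shape) and a loss budget
`4·(d S(S−1))·d·ε_k² + 4·(d(S−1)·ε_k)² ≤ θ`.  Then **`(1 − θ)·min(c_min²/(4d), a_min/4)·Σ_k S_{l_k}⁻²·Σ_{x∈cube k}|f(x)|² ≤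
⟨f, levelOp f⟩`** — for `ε_k = C/S_{l_k}` the budget is met by `θ = 8d²C²`, independent of sides, levels and volume.
[cite: Balaban1985BackgroundPropagators, (3.19) p.393 + (3.24) p.394 + (3.35) p.396 + Thm 3.1 p.397] -/
theorem multiscale_coercive_torus_cov (hd : 1 ≤ d) (S : J → ℕ) (hS : ∀ l, 1 ≤ S l) (hdivS : ∀ l i, S l ∣ N i)
    (Rm : UT N × Fin d → Cp → Cp → ℝ) (hRm : ∀ b i j, ∑ k, Rm b k i * Rm b k j = if i = j then (1 : ℝ) else 0)
    (a : J → ℝ) (ha : ∀ j, 0 ≤ a j) (ω : J → UT N → ℝ) (c : UT N × Fin d → ℝ) {cmin : ℝ} (hcmin : 0 < cmin)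
    (hc : ∀ b, cmin ≤ |c b|) (lvl : K → J) (zc : (k : K) → Ctr N (S (lvl k)))
    (hdisj : ∀ k k' v v', cellPt S hS hdivS lvl zc k v = cellPt S hS hdivS lvl zc k' v' → k = k')
    {amin : ℝ} (hamin : 0 ≤ amin)
    (hscale : ∀ k, amin / (S (lvl k) : ℝ) ^ 2 ≤
      a (lvl k) * ω (lvl k) (ctrU N (S (lvl k)) (zc k)) ^ 2 * (S (lvl k) : ℝ) ^ d)
    (g : (k : K) → Box d (S (lvl k)) → Cp → Cp → ℝ)
    (hg : ∀ k v i i', ∑ k', g k v k' i * g k v k' i' = if i = i' then (1 : ℝ) else 0) (ε : K → ℝ) (hε : ∀ k, 0 ≤ ε k)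
    (hgauge : ∀ k (v : Box d (S (lvl k))) (i : Fin d) (hv : (v i : ℕ) + 1 < S (lvl k)) (u : Cp → ℝ),
      ∑ a', (∑ j, (hol Rm (g k) (fun v i _ => (cellPt S hS hdivS lvl zc k v, i)) v i hv a' j -
        if a' = j then 1 else 0) * u j) ^ 2 ≤ ε k ^ 2 * ∑ j, u j ^ 2)
    {θ : ℝ} (hloss : ∀ k, 4 * ((d : ℝ) * (S (lvl k)) * ((S (lvl k) : ℝ) - 1)) * d * ε k ^ 2 +
      4 * ((d * (S (lvl k) - 1) : ℕ) * ε k) ^ 2 ≤ θ)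
    (f : UT N × Cp → ℝ) :
    (1 - θ) * min (cmin ^ 2 / (4 * d)) (amin / 4) *
        ∑ k, ((S (lvl k) : ℝ) ^ 2)⁻¹ * ∑ v : Box d (S (lvl k)), ∑ i, f (cellPt S hS hdivS lvl zc k v, i) ^ 2 ≤
      ∑ p, f p * levelOp bsrc btgt c Rm
        (fun l x => ctrU N (S l) (tblk (hS l) (hdivS l) x)) (fun l x => ω l (ctrU N (S l) (tblk (hS l) (hdivS l) x)))
        (fun l x => (torusComb (hS l) (hdivS l)).tr Rm x) a f p := by
  -- the torus-read gauges and the comparison rotations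
  let gT : K → UT N → Cp → Cp → ℝ := fun k x => gext (hS (lvl k)) (g k) x
  let O : K → Cp → Cp → ℝ := fun k => gT k ((torusComb (hS (lvl k)) (hdivS (lvl k))).base (zc k))
  have hgT : ∀ k x i i', ∑ k', gT k x k' i * gT k x k' i' = if i = i' then (1 : ℝ) else 0 := fun k x => hg k _
  have hgφ : ∀ k, (fun v => gT k (cellPt S hS hdivS lvl zc k v)) = g k := fun k =>
    funext fun v => gext_cubePt (hS (lvl k)) (hdivS (lvl k)) (g k) (zc k) v
  -- the comparison datum δ_k = D_k ε_k from part (G), block-local form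
  have hcmp : ∀ k (v : Box d (S (lvl k))) (u : Cp → ℝ),
      ∑ a', (∑ j, cmpD (fun v => (torusComb (hS (lvl k)) (hdivS (lvl k))).tr Rm (cellPt S hS hdivS lvl zc k v))
        (g k) (O k) v a' j * u j) ^ 2 ≤ ((d * (S (lvl k) - 1) : ℕ) * ε k) ^ 2 * ∑ j, u j ^ 2 := by
    intro k v u
    have h := hcmp_of_comb_on (torusComb (hS (lvl k)) (hdivS (lvl k))) Rm (gT k) hRm (hgT k) (hε k) (zc k)
      (comb_gauge_of_cube_gauge (hS (lvl k)) (hdivS (lvl k)) (zc k) Rm (g k) (hgauge k))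
      (cellPt S hS hdivS lvl zc k) (fun v => tblk_cubePt (hS (lvl k)) (hdivS (lvl k)) (zc k) v)
      (D := d * (S (lvl k) - 1)) (fun v => tdepth_le (hS (lvl k)) _) v u
    rw [hgφ k] at h
    exact h
  have h := multiscale_coercive_gauge_scaled (ν := d) bsrc btgt c Rm
    (fun l x => ctrU N (S l) (tblk (hS l) (hdivS l) x)) (fun l x => ω l (ctrU N (S l) (tblk (hS l) (hdivS l) x)))
    (fun l x => (torusComb (hS l) (hdivS l)).tr Rm x) a (fun k => S (lvl k)) lvl (fun k => ctrU N (S (lvl k)) (zc k))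
    (fun k => ω (lvl k) (ctrU N (S (lvl k)) (zc k))) ε (fun k => (d * (S (lvl k) - 1) : ℕ) * ε k)
    (cellPt S hS hdivS lvl zc) (fun k v i _ => (cellPt S hS hdivS lvl zc k v, i)) g O
    (fun l x i i' => (torusComb (hS l) (hdivS l)).tr_orth Rm hRm x i i') hcmin
    (fun k => cubePt_injective (hS (lvl k)) (hdivS (lvl k)) (zc k))
    (fun k x => by
      show _ ↔ ∃ v, cubePt (hS (lvl k)) (hdivS (lvl k)) (zc k) v = x
      rw [← tblk_eq_iff (hS (lvl k)) (hdivS (lvl k)) x (zc k)]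
      exact ⟨fun h => ctrU_injective (hS (lvl k)) h, fun h => by rw [h]⟩)
    (fun k v => by simp only [cellPt, tblk_cubePt])
    (fun k v i hv => rfl)
    (fun k v i hv => by
      simp only [cellPt, btgt_apply]
      exact up_cubePt (hS (lvl k)) (hdivS (lvl k)) (zc k) v i hv)
    (fun k v i hv => hc _) hg (fun k => hgT k _) hgauge hcmp
    (hbond_torus S hS hdivS lvl zc hdisj) (hcell_torus S hS hdivS lvl zc hdisj a ha)
    hd (fun k => hS (lvl k)) hamin hscale (θ := θ) (fun k => hloss k) f
  exact h

end End

end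

end Summit.QuantumFields.BalabanUV.Beta.MultiscaleCoerciveTorusCov
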